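/- Copyright: the b2b-balaban cell (near-miss cell 7), T⁴-continuum fan-out; row NE7b OWNER lineage `t4-ne7b-p1`
(gen 58) — the refuter's located question Q-ref-g31-1 (a) (PRICING-NE7b v31 F176) in the kernel, part 1 of 2 (generic
in the key map): «WHERE THE OUTER-SUMMAND MULTIPLICITY SITS».  Released under the licence of the surrounding project. -/
import Summits.QuantumFields.BalabanUV.T4Continuum.Support.HistoryBankingFibreEnvelope

/-!
# The outer summand of (1.72) on a key fibre, part 1: the SUPSUM decomposed by outer summand, the pinning clause and
what it buys, and the slice supremum of the curly weight in closed form (generic in the key map)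

Summits-side support leaf of the T⁴-continuum cell (rung (B)+1 on a FINITE torus only; NOT infinite volume, NOT the
mass gap, NOT the Clay statement; NOT a proof of the spine estimate NE7b — the cell's OWN estimate, NOT PRINTED, NOT
PROVED).  [folklore] finite combinatorics over M1's index (`B16HistoryIndexedRepr.HIndex`; `HIndex.Idx`, `termSet`),
leaf-02's slice (`HistoryBankingFibreDecorSlice`: `SIdx`, `sliceOf`, `CslOf`), the owner's g56 count and g57 SUPSUM
(`HistoryBankingFibreCount`: `pairsOf`, `mkIdx`; `HistoryBankingFibreEnvelope`: `supOf`, `supSum`, `cwOf`) and M2 brick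
B's factor data (`B16HistoryInputFamily`: `HistFactors.wC`∕`BV`); ONE displayed clause `OuterPinnedAt` (a `Prop` over OUR
carriers, used only as a binder; REFUTED at the letters of record on a toy in part 2), no `[cite:]` tag, no fact of
Bałaban's, zero `sorry`.  B16 = [Balaban1989LargeFieldII] (1.71)∕(1.72) pp. 378–379 (the outer double sum
`Σ_{Z_k} Σ_{{Y_i}}` with its inner history sums) and (1.90)∕(1.97)–(1.100) pp. 388–390 (the curly bracket's polymer
expansion, activity bound and exponentiation) are quoted as LOCATORS only; nothing printed is asserted.

WHY.  After g57's `exists_kdV_iff_supSum` the (ρ2) item of the (α) record of record reads, per cutoff `K`, source `t`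
and bad key class `k`: `supSum kmemA K k (cwOf Φf t) ≤ W K` — the sum over the slices `⟨K, a, c⟩` MET in the fibre of
`k` of the suprema over the history pairs of `|wC K t a c|·e^{BV}`.  The refuter's PRICING-NE7b v31 F176 located where a
T-dependence can enter the VALUE of that sentence — «(ρ2·a) the OUTER-SUMMAND MULTIPLICITY per key × (ρ2·b∕c) the curly
bracket with its last exponential» — and asked (Q-ref-g31-1 (a)) whether the key PINS the outer summand
`a = (Z_K, {Y_i})` on the slices met, or whether the a-multiplicity is paid inside `W K`.  This part shows, for ANY key
map, WHERE that multiplicity sits and what a pinning clause would buy; part 2 (`HistoryBankingFibreOuterSummandRecord`)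
decides the clause at the letters of record (it FAILS as typed).

WHAT.  §1 **`mk_mem_CslOf_iff`** (the slice `⟨K, a, c⟩` is met iff g56's history-pair set `pairsOf K k a c` is nonempty),
**`cMet kmem K k a`** (the curly summands of `a` whose slice is met; `cMet_subset`, `mem_cMet`, `exists_eq_of_mem_CslOf`),
**`CslOf_eq_map_sigma`** (the slice set met is the tagged disjoint union over the outer summands of the `cMet`),
**`card_CslOf_eq_sum`** (`#CslOf = Σ_a #cMet a`), **`supSum_eq_sum_outer`** (`supSum kmem K k cw =
Σ_a Σ_{c ∈ cMet a} supOf … ⟨K, a, c⟩`) and `sum_cMet_supOf_le_supSum`: THE OUTER-SUMMAND MULTIPLICITY PER KEY IS INSIDE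
THE LEFT SIDE OF (ρ2)'s ONE INEQUALITY — paid by `W K`; carried by neither (ρ1) (which counts history pairs at FIXED
`(a, c)`) nor (ρ3).  §2 the displayed clause **`OuterPinnedAt kmem K k`** («two fibre terms of the key at the cutoff have
the same outer summand») and what it buys: `cMet_eq_empty_of_ne`, **`CslOf_eq_image_of_pinned`** (the slices met are ONE
outer summand's), **`card_CslOf_le_of_pinned`** (`#CslOf ≤ #HCs a₀`), **`supSum_eq_of_pinned`**
(`supSum = Σ_{c ∈ cMet a₀} supOf ⟨K, a₀, c⟩`).  §3 the refuter's optional corollary F176 (4) **`supOf_cwOf_mk_eq`**: on a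
met slice `supOf kmem K k (cwOf Φf t) ⟨K, a, c⟩ = |wC K t a c| · sup'_{(h,ℓ) ∈ pairsOf K k a c} e^{BV K t a h ℓ c}` — the
curly normalisation is slice-constant, so the pair-supremum bites on the last-exponent envelope `BV` ALONE (F176 (1) in
the kernel); off the pairs it is the floor `0` (`supOf_mk_eq_zero_of_pairsOf_eq_empty`).

HONEST SCOPE.  Bookkeeping over OUR carriers: a finite-sum decomposition, its one-summand case under a displayed
clause, a `max'` identity.  Nothing of Bałaban's is asserted, valued or discharged; (ρ2) is NOT discharged and its VALUE
`W K` is print's claim ∕ the T-extensive `W∞` as before.  BY-NAME EFFECT ON THE WALL: row `resum`∕(ρ) — (ρ2)'s residue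
WORDED «(outer-summand multiplicity per key — inside `W K`; `= 1` under a pinning clause) × (the exponentiated curly
bracket's envelope)»; R∕T-rows by count UNCHANGED.  NE7b NOT PRINTED ∕ NOT PROVED; spine 0∕9.  HONEST DEPENDENCY
(cell): continuum YM on T⁴ ⇐ BetaPertH ∧ nine spine estimates (0/9 proved); BetaPertH ⇐ (D1) ∧ (D4) ∧ CAP+tail;
G-an2-4 gates asym, D1 and NE2/3/4.  This file changes none of it.
-/

open Finset
open Literature.MathematicalPhysics.QuantumFieldTheory.Balaban1983to89
open T4PersistenceDictionary T4LiveClassFibration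
open Summit.QuantumFields.BalabanUV.T4Continuum.HistoryPriceKeys
open Summit.QuantumFields.BalabanUV.T4Continuum.HistoryBankingFibreDecorSlice
open Summit.QuantumFields.BalabanUV.T4Continuum.HistoryBankingFibreCount
open Summit.QuantumFields.BalabanUV.T4Continuum.HistoryBankingFibreEnvelope
open Summit.QuantumFields.BalabanUV.T4Continuum.B16HistoryIndexedRepr

namespace Summit.QuantumFields.BalabanUV.T4Continuum.HistoryBankingFibreOuterSummand

noncomputable section

variable {DomK : ℕ → Type*} {I : (K : ℕ) → HIndex (DomK K)} {ω : Type*} [DecidableEq ω]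

/-! ## §1 The curly slices met per outer summand; the SUPSUM decomposed by outer summand -/

section Generic

variable {kmem : ℕ → HIndex.Idx I → Finset ω} {K : ℕ} {k : Finset ω}

/-- **A SLICE IS MET IFF ITS HISTORY-PAIR SET IS NONEMPTY** (g56's `pairsOf` is the index (ρ2)'s supremum ranges over).
[folklore] -/
theorem mk_mem_CslOf_iff {a : (I K).Adm} {c : (I K).HC} :
    (⟨K, a, c⟩ : SIdx I) ∈ CslOf I kmem K k ↔ (pairsOf kmem K k a c).Nonempty := by
  constructor
  · intro hs
    obtain ⟨τ, hτ, hsl⟩ := mem_CslOf.1 hs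
    obtain ⟨a', h', l', c', -, rfl⟩ := eq_of_mem_termSet (mem_fibre.1 hτ).1
    have hs' : sliceOf I ⟨K, a', (h', l', c')⟩ = sliceOf I ⟨K, a, (h', l', c)⟩ := by rw [hsl, sliceOf_mk]
    obtain ⟨rfl, rfl⟩ := sliceOf_eq_iff.1 hs'
    exact ⟨(h', l'), mem_pairsOf.2 hτ⟩
  · rintro ⟨p, hp⟩
    rw [← sliceOf_mk I K a p.1 p.2 c]
    exact sliceOf_mem_CslOf (mem_pairsOf.1 hp)

variable (kmem K k) in
open Classical in
/-- **THE CURLY SLICES MET AT THE OUTER SUMMAND `a`**: the curly summands `c ∈ HCs a` of the cutoff-`K` skeleton whose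
slice `⟨K, a, c⟩` is met in the fibre of the key `k`. [folklore] -/
def cMet (a : (I K).Adm) : Finset (I K).HC := ((I K).HCs a).filter fun c => (⟨K, a, c⟩ : SIdx I) ∈ CslOf I kmem K k

open Classical in
/-- the curly slices met lie among the outer summand's curly summands [folklore] -/
theorem cMet_subset (a : (I K).Adm) : cMet kmem K k a ⊆ (I K).HCs a := by
  unfold cMet
  exact Finset.filter_subset _ _

open Classical in
/-- membership in the curly slices met: exactly that the slice is met (its `HCs`-membership is implied) [folklore] -/
theorem mem_cMet {a : (I K).Adm} {c : (I K).HC} : c ∈ cMet kmem K k a ↔ (⟨K, a, c⟩ : SIdx I) ∈ CslOf I kmem K k := by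
  unfold cMet
  rw [Finset.mem_filter]
  refine ⟨fun h => h.2, fun h => ⟨?_, h⟩⟩
  obtain ⟨p, hp⟩ := mk_mem_CslOf_iff.1 h
  have ht := mk_mem_termSet_iff.1 (mem_fibre.1 (mem_pairsOf.1 hp)).1
  unfold HIndex.LIdx at ht
  exact (Finset.mem_product.1 (Finset.mem_product.1 ht).2).2

/-- a slice met at cutoff `K` is an explicit `⟨K, a, c⟩` with `c` a curly slice met at `a` [folklore] -/
theorem exists_eq_of_mem_CslOf {s : SIdx I} (hs : s ∈ CslOf I kmem K k) :
    ∃ (a : (I K).Adm) (c : (I K).HC), c ∈ cMet kmem K k a ∧ s = ⟨K, a, c⟩ := by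
  obtain ⟨τ, hτ, rfl⟩ := mem_CslOf.1 hs
  obtain ⟨a, h, l, c, -, rfl⟩ := eq_of_mem_termSet (mem_fibre.1 hτ).1
  exact ⟨a, c, mem_cMet.2 (sliceOf_mk I K a h l c ▸ sliceOf_mem_CslOf hτ), sliceOf_mk I K a h l c⟩

variable (kmem K k) in
/-- the tagging of the cutoff-`K` pairs (outer summand, curly summand) into the slice index type [folklore] -/
def tagK : (Σ _ : (I K).Adm, (I K).HC) ↪ SIdx I := Function.Embedding.sigmaMk (β := fun K => Σ _ : (I K).Adm, (I K).HC) K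

variable (kmem K k) in
/-- **THE SLICE SET MET IS THE TAGGED DISJOINT UNION, OVER THE OUTER SUMMANDS, OF THE CURLY SLICES MET.** [folklore] -/
theorem CslOf_eq_map_sigma :
    CslOf I kmem K k = ((Finset.univ : Finset (I K).Adm).sigma (cMet kmem K k)).map (tagK (I := I) K) := by
  ext s
  rw [Finset.mem_map]
  constructor
  · intro hs
    obtain ⟨a, c, hc, rfl⟩ := exists_eq_of_mem_CslOf hs
    exact ⟨⟨a, c⟩, Finset.mem_sigma.2 ⟨Finset.mem_univ _, hc⟩, rfl⟩
  · rintro ⟨⟨a, c⟩, hp, rfl⟩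
    exact mem_cMet.1 (Finset.mem_sigma.1 hp).2

variable (kmem K k) in
/-- **THE NUMBER OF SLICES MET IS THE SUM OVER THE OUTER SUMMANDS OF THE NUMBER OF CURLY SLICES MET.** [folklore] -/
theorem card_CslOf_eq_sum : (CslOf I kmem K k).card = ∑ a : (I K).Adm, (cMet kmem K k a).card := by
  rw [CslOf_eq_map_sigma kmem K k, Finset.card_map, Finset.card_sigma]

variable (kmem K k) in
/-- **THE SUPSUM DECOMPOSED BY OUTER SUMMAND**: `supSum kmem K k cw = Σ_a Σ_{c ∈ cMet K k a} supOf kmem K k cw ⟨K, a, c⟩` —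
the outer-summand multiplicity per key sits INSIDE the left side of (ρ2)'s one inequality `supSum ≤ W K`. [folklore] -/
theorem supSum_eq_sum_outer (cw : HIndex.Idx I → ℝ) :
    supSum kmem K k cw = ∑ a : (I K).Adm, ∑ c ∈ cMet kmem K k a, supOf kmem K k cw ⟨K, a, c⟩ := by
  rw [supSum_eq, CslOf_eq_map_sigma kmem K k, Finset.sum_map, Finset.sum_sigma]
  rfl

variable (kmem K k) in
/-- **ONE OUTER SUMMAND's SHARE IS BELOW THE SUPSUM** (so under (ρ2) each met outer summand's curly suprema sum to at
most `W K` on their own — the converse direction is where the multiplicity is paid). [folklore] -/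
theorem sum_cMet_supOf_le_supSum (cw : HIndex.Idx I → ℝ) (a : (I K).Adm) :
    ∑ c ∈ cMet kmem K k a, supOf kmem K k cw ⟨K, a, c⟩ ≤ supSum kmem K k cw := by
  rw [supSum_eq_sum_outer kmem K k cw]
  exact Finset.single_le_sum (f := fun a => ∑ c ∈ cMet kmem K k a, supOf kmem K k cw ⟨K, a, c⟩)
    (fun a _ => Finset.sum_nonneg fun _ _ => supOf_nonneg) (Finset.mem_univ a)

/-! ## §2 The pinning clause and what it buys -/

variable (kmem K k) in
/-- **THE PINNING CLAUSE** (a READING, displayed — never asserted): two terms of the fibre of the key `k` at cutoff `K`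
have the same outer summand `a = (Z_K, {Y_i})` of (1.72). [folklore] -/
def OuterPinnedAt : Prop :=
  ∀ (a a' : (I K).Adm) (ι ι' : (I K).HZ × (I K).HL × (I K).HC),
    (⟨K, a, ι⟩ : HIndex.Idx I) ∈ fibre kmem (HIndex.termSet I) K k →
    (⟨K, a', ι'⟩ : HIndex.Idx I) ∈ fibre kmem (HIndex.termSet I) K k → a = a'

/-- **UNDER THE PIN, NO OTHER OUTER SUMMAND MEETS A SLICE**: with a fibre term of outer summand `a₀`, `cMet … a = ∅` for
`a ≠ a₀`. [folklore] -/
theorem cMet_eq_empty_of_ne (hpin : OuterPinnedAt kmem K k) {a₀ : (I K).Adm} {ι₀ : (I K).HZ × (I K).HL × (I K).HC}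
    (h₀ : (⟨K, a₀, ι₀⟩ : HIndex.Idx I) ∈ fibre kmem (HIndex.termSet I) K k) {a : (I K).Adm} (ha : a ≠ a₀) :
    cMet kmem K k a = ∅ :=
  Finset.eq_empty_of_forall_notMem fun c hc => by
    obtain ⟨p, hp⟩ := mk_mem_CslOf_iff.1 (mem_cMet.1 hc)
    exact ha (hpin a a₀ (p.1, p.2, c) ι₀ (mem_pairsOf.1 hp) h₀)

open Classical in
/-- **UNDER THE PIN THE SLICES MET ARE ONE OUTER SUMMAND's CURLY SLICES MET.** [folklore] -/
theorem CslOf_eq_image_of_pinned (hpin : OuterPinnedAt kmem K k) {a₀ : (I K).Adm}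
    {ι₀ : (I K).HZ × (I K).HL × (I K).HC} (h₀ : (⟨K, a₀, ι₀⟩ : HIndex.Idx I) ∈ fibre kmem (HIndex.termSet I) K k) :
    CslOf I kmem K k = (cMet kmem K k a₀).image fun c => (⟨K, a₀, c⟩ : SIdx I) := by
  ext s
  rw [Finset.mem_image]
  constructor
  · intro hs
    obtain ⟨a, c, hc, rfl⟩ := exists_eq_of_mem_CslOf hs
    by_cases ha : a = a₀
    · subst ha
      exact ⟨c, hc, rfl⟩
    · rw [cMet_eq_empty_of_ne hpin h₀ ha] at hc
      exact absurd hc (Finset.notMem_empty _)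
  · rintro ⟨c, hc, rfl⟩
    exact mem_cMet.1 hc

open Classical in
/-- **UNDER THE PIN AT MOST `#HCs a₀` SLICES ARE MET** (the outer-summand multiplicity per key is `1`). [folklore] -/
theorem card_CslOf_le_of_pinned (hpin : OuterPinnedAt kmem K k) {a₀ : (I K).Adm}
    {ι₀ : (I K).HZ × (I K).HL × (I K).HC} (h₀ : (⟨K, a₀, ι₀⟩ : HIndex.Idx I) ∈ fibre kmem (HIndex.termSet I) K k) :
    (CslOf I kmem K k).card ≤ ((I K).HCs a₀).card := by
  rw [CslOf_eq_image_of_pinned hpin h₀]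
  exact Finset.card_image_le.trans (Finset.card_le_card (cMet_subset a₀))

/-- **UNDER THE PIN THE SUPSUM IS ONE OUTER SUMMAND's SUM OF CURLY SUPREMA.** [folklore] -/
theorem supSum_eq_of_pinned (hpin : OuterPinnedAt kmem K k) {a₀ : (I K).Adm}
    {ι₀ : (I K).HZ × (I K).HL × (I K).HC} (h₀ : (⟨K, a₀, ι₀⟩ : HIndex.Idx I) ∈ fibre kmem (HIndex.termSet I) K k)
    (cw : HIndex.Idx I → ℝ) :
    supSum kmem K k cw = ∑ c ∈ cMet kmem K k a₀, supOf kmem K k cw ⟨K, a₀, c⟩ := by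
  rw [supSum_eq_sum_outer kmem K k cw]
  rw [Finset.sum_eq_single a₀ (fun a _ ha => by rw [cMet_eq_empty_of_ne hpin h₀ ha, Finset.sum_empty])
    (fun h => absurd (Finset.mem_univ a₀) h)]

end Generic

/-! ## §3 The slice supremum of the curly weight in closed form: the pair-supremum bites on `BV` alone -/

section Closed

variable {kmem : ℕ → HIndex.Idx I → Finset ω} {K : ℕ} {k : Finset ω} {d : ℕ}

/-- **THE SLICE SUPREMUM OF THE CURLY WEIGHT ON A MET SLICE** (the refuter's F176 (4)):
`supOf kmem K k (cwOf Φf t) ⟨K, a, c⟩ = |wC K t a c| · sup'_{(h, ℓ) ∈ pairsOf K k a c} e^{BV K t a h ℓ c}` — the curly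
normalisation is slice-constant, so the supremum over the history pairs bites on the last-exponent envelope alone.
[folklore] -/
theorem supOf_cwOf_mk_eq (Φf : HistFactors I d) (t : ℝ) {a : (I K).Adm} {c : (I K).HC}
    (hne : (pairsOf kmem K k a c).Nonempty) :
    supOf kmem K k (cwOf Φf t) ⟨K, a, c⟩ =
      |Φf.wC K t a c| * (pairsOf kmem K k a c).sup' hne (fun p => Real.exp (Φf.BV K t a p.1 p.2 c)) := by
  apply le_antisymm
  · obtain ⟨p₀, hp₀⟩ := hne
    have h0 : 0 ≤ (pairsOf kmem K k a c).sup' ⟨p₀, hp₀⟩ (fun p => Real.exp (Φf.BV K t a p.1 p.2 c)) :=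
      (Real.exp_pos _).le.trans (Finset.le_sup' (fun p => Real.exp (Φf.BV K t a p.1 p.2 c)) hp₀)
    refine (supOf_mk_le_iff (mul_nonneg (abs_nonneg _) h0)).2 fun p hp => ?_
    rw [cwOf_mk]
    exact mul_le_mul_of_nonneg_left (Finset.le_sup' (fun p => Real.exp (Φf.BV K t a p.1 p.2 c)) hp) (abs_nonneg _)
  · obtain ⟨p, hp, hpe⟩ := Finset.exists_mem_eq_sup' hne (fun p => Real.exp (Φf.BV K t a p.1 p.2 c))
    rw [hpe, ← cwOf_mk]
    exact le_supOf_mk hp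

/-- off the history pairs the slice supremum of any weight is the floor `0` (the slice is not met) [folklore] -/
theorem supOf_mk_eq_zero_of_pairsOf_eq_empty (cw : HIndex.Idx I → ℝ) {a : (I K).Adm} {c : (I K).HC}
    (h : pairsOf kmem K k a c = ∅) : supOf kmem K k cw ⟨K, a, c⟩ = 0 :=
  supOf_eq_zero_of_not_mem fun hs => Finset.not_nonempty_empty (h ▸ mk_mem_CslOf_iff.1 hs)

end Closed

end

end Summit.QuantumFields.BalabanUV.T4Continuum.HistoryBankingFibreOuterSummand
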